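import Mathlib

/-!
# `Balaban1983to89.B4` — T. Bałaban, *Regularity and decay of lattice Green's functions*,
Commun. Math. Phys. **89**, 571–597 (1983).  (INDEX: B4; refs: [1], [2], [3] = (Higgs)₂,₃ I, II, III =
cell context B1–B3 (CMP 85:603, 86:555, 88:411); [4] = Brydges–Federbush CMP 62:79; [5] = Brydges–Fröhlich–Seiler
Ann. Phys. 121:227; [6] = Dunford–Schwartz I, VI.10.)
PDF held: `paper:balaban1983-cmp89-regularity-decay` (journal page = PDF page + 570; 28 pp., PDF 28 blank).

CITATION HEADER (lean-in-tree rule 2026-08-18). This module is a TYPED SKELETON (statement level) of the published paper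
T. Bałaban, "Regularity and decay of lattice Green's functions", *Comm. Math. Phys.* **89**, 571–597 (1983)
[Balaban1983RegularityDecay] (cell paper B4 — the source node of the Yang–Mills chain B4 → B5 → B6 → B7 → B9 → …).
WHAT IS REPRODUCED: EVERY numbered or named statement of the paper as `def … : Prop` carrying the VERBATIM printed
statement in the docstring (journal page [PDF page] + equation numbers): the Theorem p. 573 ("Proposition 2.1 of [1]",
(1.9)–(1.12)), the lower bound (1.8) p. 573, "Proposition 2.3 of [1]" p. 574 ((1.15)–(1.20)), "Proposition 3.1′ of [2]"
p. 574 ((1.21)–(1.22)), Lemma 2.1 p. 577 (2.15), Lemma 2.2 pp. 577–578 ((2.16)–(2.17)), the block bound (2.27) p. 580,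
Corollary 2.3 pp. 580–581 (2.30), Lemma 2.4 p. 582 ((2.35)–(2.37)), and the Sect. 5 "general theorem on unit lattice
operators" p. 594 ((5.6)–(5.10)).  The paper has NO other lemma / proposition (no Lemma 3.x, 4.x, 5.x).  The η-lattice
statements are typed over abstract carrier structures whose fields NAME the printed functionals (kernels, norms,
distances, quadratic forms) — exactly the convention of the sibling modules `…Balaban1983to89.B5`, `.B6`, `.B9`, and for
the same reason (the shared `Setup` vocabulary deliberately does not model operator kernels; nothing of `Setup` is
restated here).  The Sect. 5 Theorem, being a statement about symmetric kernels on ℓ²(Ω; ℝ^N), Ω ⊂ ℤ^d, is typed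
CONCRETELY over Mathlib (finite Ω, matrices indexed by Ω × Fin N, `Matrix.inv`, the sup-distance of ℤ^d,
`Metric.infDist`) in the two quantifier readings the print admits (`Sect5ThmLiteral`, `Sect5ThmUniform`; the proof
p. 597 establishes the uniform one: "The constants δ₁, c₁ are functions of δ₀, γ₀, c₀").
NOTHING of the series is asserted: every `…Printed` Prop is consumed downstream only as a hypothesis `(h : …Printed …)`;
the series' end-statement is a CLAIM UNDER ADJUDICATION by the audit cell `pub-balaban`.  KERNEL-CHECKED here (the
audit's "second engine", elementary arithmetic only): the constant bookkeeping of §4 ((4.4) + (4.6)–(4.7) ⇒ (1.22) with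
γ₀ = ½ min{γ₀′/2d, a_k/(a_k + O(1))}, `prop31_gamma0`; (4.11)–(4.13) ⇒ (4.7) with γ₀′ = ¼γ₀″, `gamma0prime_chain`), the
identity a_k + aL⁻² = a·a_k/a_{k+1} behind (5.1) (`recursion_51`), the walk-length-to-distance conversion behind (5.21)
(`walk_to_distance`), the observation that the constant slip min{π², a_k} of (2.27)–(2.28) (cell census G-B4-03) is
moot for a_k ≤ 8 (`display227_moot`), and `sect5_literal_of_uniform`.  NOT reproduced: the proofs (generalized random
walk expansion §2, the Gaussian-integral representation §3, the duality argument §4, the unit-lattice walk §5) — their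
line-by-line census is the cell's GAPS.md (ids G-B4-01 … G-B4-08, C-B4-…; D-b04.* = rows of the cell's DIVERGENCE.md,
quoted in the docstrings below).  GLOBAL PRINT ERRATUM recorded by the census: every in-text reference to a §1 display on
pp. 573, 588–590, 593 is low by four ("(1.5) and (1.6)" = (1.9), (1.10); "(1.11), (1.12), (1.16)" = (1.15), (1.16),
(1.20); "(1.14)" = (1.18); "(1.18)" = (1.22); "(1.11)" p. 593 = (1.15)).
Staged byte-identically in the cell package
`run/shared/lean/pub/pub-balaban/lean/BalabanYm4/Literature/MathematicalPhysics/QuantumFieldTheory/Balaban1983to89/B4.lean`.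

Unit `b2b-balaban-b04` (paper sub-cell B04, phase 2; surge nodes T01.1–T01.4).  Companion prose: the sub-cell's verbatim
transcript `HOME/b2b-balaban-b04/transcript-B4.md` (pp. 571–597 from the page renders) and the earlier leaf record
`HOME/b2b-balaban-r1/B4-leaves.md` (L-B4-1 … L-B4-7).  Downstream binding: `LeafB4` below is the intended content of the
abstract leaf `…Balaban1983to89.Dag.Leaves.b4` ("Theorem p. 573, Prop. 2.3 of I and Prop. 3.1′ of II as restated p. 574,
Sect. 5 Theorem p. 594"); consumers B5 p. 17 ("the methods and results of paper [2]"), B6 pp. 237, 242 (G-B6-05/07: the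
Sect. 5 Theorem), B9 pp. 398, 412, 426–427 (G-B9-05/08: the Theorem's δG clause (1.11)–(1.12)).
-/

namespace Literature.MathematicalPhysics.QuantumFieldTheory.Balaban1983to89.B4

variable {I : Type}

/-! ## §1–§2. The η-lattice Green's functions G_k(Ω, A): Theorem p. 573, the bound (1.8), Corollary 2.3 -/

/-- Abstract carrier for the η-lattice statements.  One INSTANCE = (d; L "a small positive integer > 1, e.g. L = 2
or 3"; M "a large positive integer defined later in this paper" — fixed for the family; k ≥ 1, η = L^{−k}; Ω ⊂ ηℤ^d or
Ω ⊂ T_η a union of big blocks (cubes of size M), Ω ⊂ Ω₀ likewise (for the δG clauses); a vector field A on bonds with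
U(A) = e^{qeηA}, q antisymmetric N × N (1.2); the charge e; m² ≥ 0 and "a positive constant a close to 1" of
G_k(Ω, A) = (−Δ^{η,N}_{A,Ω} + m² + aP_k(A))^{−1} (1.6)).  Fields NAME the printed quantities: `pdist x x′` = |x − x′|;
`sdist1 x f` = dist(x, supp f), `sdist2 x x′ f` = dist({x,x′}, supp f); `bdist1 x` = dist(x, Ωᶜ), `bdist2 x x′` =
dist({x,x′}, Ωᶜ), `bdistS f` = dist(supp f, Ωᶜ); `supNorm f` = ‖f‖_∞, `l2Norm f` = ‖f‖₂, `ssdist f f′` =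
dist(supp f, supp f′); `lhs19 α μ f x x′` = the left-hand side of (1.9), i.e.
|x − x′|^{−α}|U(A(Γ_{x,x′}))(D^η_{A,μ}G_k(Ω,A)f)(x′) − (D^η_{A,μ}G_k(Ω,A)f)(x)| (Γ_{x,x′} a shortest contour);
`valDG μ f x` = |(D^η_{A,μ}G_k(Ω,A)f)(x)|, `valG f x` = |(G_k(Ω,A)f)(x)|; `dlhs19`, `dvalDG`, `dvalG` = the same three
for δG_k(Ω,Ω₀,A) = G_k(Ω,A) − G_k(Ω₀,A) (1.11); `lower18 γ` = the operator inequality −Δ^{η,N}_{A,Ω} + aP_k(A) ≥ γI on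
L²(Ω); `pair n μ ν f f′` (n = 0…3) = |⟨f, G f′⟩|, |⟨f, D^η_{A,μ}G f′⟩|, |⟨f, G D^{η*}_{A,ν} f′⟩|, |⟨f, D^η_{A,μ}G D^{η*}_{A,ν}f′⟩|
for G = G_k(Ω,A), and `dpair` the same for δG_k(Ω,Ω₀,A).  Printed hypotheses as predicates: `regular` = A is regular on
Ω in the sense of (1.7) |(∂^η_μA)(x)| ≤ ce^{β−1} ("c is some universal constant", β > 0); `bigBlocks` = Ω (and Ω₀) are
unions of big blocks; `rect` = Ω is a rectangular parallelepiped. [cite: Balaban1983RegularityDecay, §1 (1.1)–(1.7) pp.572–573] -/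
structure EtaSetting where
  Site : Type
  Dir : Type
  Src : Type
  e : ℝ
  regular : Prop
  bigBlocks : Prop
  rect : Prop
  pdist : Site → Site → ℝ
  sdist1 : Site → Src → ℝ
  sdist2 : Site → Site → Src → ℝ
  bdist1 : Site → ℝ
  bdist2 : Site → Site → ℝ
  bdistS : Src → ℝ
  supNorm : Src → ℝ
  l2Norm : Src → ℝ
  ssdist : Src → Src → ℝ
  lhs19 : ℝ → Dir → Src → Site → Site → ℝ
  valDG : Dir → Src → Site → ℝ
  valG : Src → Site → ℝ
  dlhs19 : ℝ → Dir → Src → Site → Site → ℝ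
  dvalDG : Dir → Src → Site → ℝ
  dvalG : Src → Site → ℝ
  lower18 : ℝ → Prop
  pair : Fin 4 → Dir → Dir → Src → Src → ℝ
  dpair : Fin 4 → Dir → Dir → Src → Src → ℝ

/-- **(1.8)** (p. 573 [PDF 3], verbatim): *"The operator defining the Green's function (1.6) has a strictly positive
lower bound. More exactly we prove that there exists a positive constant γ₀ such that for e sufficiently small and for a
regular vector field A, −Δ^{η,N}_{A,Ω} + aP_k(A) ≥ γ₀I. (1.8)  The constant γ₀ is independent of the lattice spacing η, as
well as of Ω and of A."*  Quantifier order: γ₀ and the smallness threshold e₁ before the instance. [cite: Balaban1983RegularityDecay, (1.8) p.573] -/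
def Claim18Printed (fam : I → EtaSetting) : Prop :=
  ∃ γ₀ e₁ : ℝ, 0 < γ₀ ∧ 0 < e₁ ∧ ∀ i : I,
    (fam i).regular → 0 < (fam i).e → (fam i).e ≤ e₁ → (fam i).lower18 γ₀

/-- (1.9)–(1.10) for one instance with constants (α, δ₀, c₀, R₀): the restriction "dist({x,x′}, Ωᶜ) ≥ R₀" (resp.
"dist(x, Ωᶜ) ≥ R₀") is waived when Ω is a rectangular parallelepiped (last sentence of the Theorem). [cite: Balaban1983RegularityDecay, (1.9)–(1.10) p.573] -/
def Ineq19_110 (S : EtaSetting) (α δ₀ c₀ R₀ : ℝ) : Prop :=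
  (∀ (μ : S.Dir) (f : S.Src) (x x' : S.Site), (S.rect ∨ R₀ ≤ S.bdist2 x x') →
      S.lhs19 α μ f x x' ≤ c₀ * Real.exp (-(δ₀ * S.sdist2 x x' f)) * S.supNorm f) ∧
  (∀ (μ : S.Dir) (f : S.Src) (x : S.Site), (S.rect ∨ R₀ ≤ S.bdist1 x) →
      S.valDG μ f x ≤ c₀ * Real.exp (-(δ₀ * S.sdist1 x f)) * S.supNorm f ∧
      S.valG f x ≤ c₀ * Real.exp (-(δ₀ * S.sdist1 x f)) * S.supNorm f)

/-- (1.11)–(1.12) for one instance: (1.9)–(1.10) for δG_k(Ω,Ω₀,A) "with the same restrictions on x, x′" and "with the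
additional factor (1.12)".  PRINT DEFECT (cell census G-B4-01, RESOLVED from the paper's own proof): (1.12) is printed as
"exp(−δ₀ dist(supp f, Ωᶜ) − δ₀ dist(supp f, Ωᶜ))" (the same distance twice); the proof, p. 579 [PDF 9], derives the factor
from the walk-length restriction *"n ≥ M^{−1} sup_{x₁∈Ωᶜ}(dist({x,x′},x₁) + dist(x₁, supp f)) − 3 ≥
(2M)^{−1}(dist({x,x′}, supp f) + dist({x,x′}, Ωᶜ) + dist(supp f, Ωᶜ)) − 3"*, and Corollary 2.3 (p. 581) prints the
analogous factor as "e^{−δ₀(dist(supp f,Ωᶜ) + dist(supp f′,Ωᶜ))}" (one distance per argument); hence the typed factor is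
exp(−δ₀ dist({x,x′}, Ωᶜ) − δ₀ dist(supp f, Ωᶜ)) (resp. dist(x, Ωᶜ) in (1.10)) — DIVERGENCE D-b04.2. [cite: Balaban1983RegularityDecay, (1.11)–(1.12) p.573 + proof p.579] -/
def Ineq111_112 (S : EtaSetting) (α δ₀ c₀ R₀ : ℝ) : Prop :=
  (∀ (μ : S.Dir) (f : S.Src) (x x' : S.Site), (S.rect ∨ R₀ ≤ S.bdist2 x x') →
      S.dlhs19 α μ f x x' ≤ c₀ * Real.exp (-(δ₀ * S.sdist2 x x' f)) *
        Real.exp (-(δ₀ * S.bdist2 x x' + δ₀ * S.bdistS f)) * S.supNorm f) ∧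
  (∀ (μ : S.Dir) (f : S.Src) (x : S.Site), (S.rect ∨ R₀ ≤ S.bdist1 x) →
      S.dvalDG μ f x ≤ c₀ * Real.exp (-(δ₀ * S.sdist1 x f)) *
        Real.exp (-(δ₀ * S.bdist1 x + δ₀ * S.bdistS f)) * S.supNorm f ∧
      S.dvalG f x ≤ c₀ * Real.exp (-(δ₀ * S.sdist1 x f)) *
        Real.exp (-(δ₀ * S.bdist1 x + δ₀ * S.bdistS f)) * S.supNorm f)

/-- **Theorem (Proposition 2.1 of [1])** (p. 573 [PDF 3], verbatim; surge node T01.1): *"For α < 1 there exist positive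
constants δ₀, c₀, R₀ independent of A, k, Ω and depending on d, M only, c₀ on α also, such that for e sufficiently small
and for an arbitrary function f : Ω → R^N, we have
|x − x′|^{−α}|U(A(Γ_{x,x′}))(D^η_{A,μ}G_k(Ω,A)f)(x′) − (D^η_{A,μ}G_k(Ω,A)f)(x)| ≤ c₀ exp(−δ₀ dist({x,x′}, supp f))‖f‖_∞ (1.9)
for x, x′ ∈ Ω, and satisfying the condition dist({x,x′}, Ωᶜ) ≥ R₀. Similarly
|(D^η_{A,μ}G_k(Ω,A)f)(x)|, |(G_k(Ω,A)[f])(x)| ≤ c₀ exp(−δ₀ dist(x, supp f))‖f‖_∞ (1.10)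
for x ∈ Ω, dist(x, Ωᶜ) ≥ R₀. If Ω ⊂ Ω₀, then for δG_k(Ω,Ω₀,A) defined by the equality δG_k(Ω,Ω₀,A) = G_k(Ω,A) − G_k(Ω₀,A),
(1.11) we have the inequalities (1.5) and (1.6) [sic: (1.9) and (1.10)] (with the same restrictions on x, x′) with the
additional factor exp(−δ₀ dist(supp f, Ωᶜ) − δ₀ dist(supp f, Ωᶜ)) (1.12) [see `Ineq111_112`] on the right hand sides.
For some simple sets Ω, e.g. for rectangular parallelepipeds, the inequalities hold without any restrictions on the points
x, x′, i.e. for all x, x′ ∈ Ω."*  Standing hypotheses (p. 572): Ω a union of big blocks, A regular (1.7).  Quantifier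
order (literal): α, then (δ₀, c₀, R₀) and the smallness threshold e₁, then the instance i = (k, Ω ⊂ Ω₀, A, e).  Printed
proof structure (p. 579: "Thus we have proved the theorem, or rather reduced it to Lemmas 2.1, 2.2"; p. 586: "Thus we have
proved Lemma 2.4, hence also the Theorem"): Theorem ⇐ random walk representation (2.13) + `Lemma21Printed` +
`Lemma22Printed`; Lemma 2.2 ⇐ `Lemma24Printed` (p. 583); census G-B4-02 sits inside the proof of Lemma 2.4. [cite: Balaban1983RegularityDecay, Theorem (1.9)–(1.12) p.573] -/
def ThmPrinted (fam : I → EtaSetting) : Prop :=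
  ∀ α : ℝ, α < 1 → ∃ δ₀ c₀ R₀ e₁ : ℝ, 0 < δ₀ ∧ 0 < c₀ ∧ 0 < R₀ ∧ 0 < e₁ ∧ ∀ i : I,
    (fam i).regular → (fam i).bigBlocks → 0 < (fam i).e → (fam i).e ≤ e₁ →
      Ineq19_110 (fam i) α δ₀ c₀ R₀ ∧ Ineq111_112 (fam i) α δ₀ c₀ R₀

/-- **Corollary 2.3** (pp. 580–581 [PDF 10–11], verbatim): *"Remark. Let us notice that this lemma [Lemma 2.1] alone
implies a weaker version of Proposition I.2.1 with L²-norms. More exactly we have  Corollary 2.3. If Ω and A are as in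
Proposition I.2.1, then there exist positive constants c₀, δ₀ such that for arbitrary scalar field configurations f, f′
defined on Ω, we have |⟨f, G_k(Ω,A)f′⟩|, |⟨f, D^η_{A,μ}G_k(Ω,A)f′⟩|, |⟨f, G_k(Ω,A)D^{η*}_{A,ν}f′⟩|,
|⟨f, D^η_{A,μ}G_k(Ω,A)D^{η*}_{A,ν}f′⟩| ≤ c₀e^{−δ₀dist(supp f, supp f′)}‖f‖₂‖f′‖₂. (2.30)  The same inequalities hold for
δG_k(Ω,Ω₀,A) with the additional factor e^{−δ₀(dist(supp f,Ωᶜ) + dist(supp f′,Ωᶜ))}. Of course it is enough to prove it for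
f, f′ with supports in unit cubes, and the proof proceeds as before using only the L²-bounds of Lemma 2.1. Let us notice
also that now there are no restrictions on supports of f, f′, so in this aspect the Corollary is a little bit stronger than
Proposition I.2.1."*  The work-horse of §§3–5: (1.15)–(1.20) (p. 588), (2.37) (p. 584), (3.10), (5.4)–(5.5) are all
derived from it; p. 588 asserts it also for G_k(Ω,Λ,A) of (3.5) "with only slight changes" (census G-B4-04). [cite: Balaban1983RegularityDecay, Cor. 2.3 (2.30) pp.580–581] -/
def Cor23Printed (fam : I → EtaSetting) : Prop :=
  ∃ c₀ δ₀ e₁ : ℝ, 0 < c₀ ∧ 0 < δ₀ ∧ 0 < e₁ ∧ ∀ i : I,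
    (fam i).regular → (fam i).bigBlocks → 0 < (fam i).e → (fam i).e ≤ e₁ →
    ∀ (n : Fin 4) (μ ν : (fam i).Dir) (f f' : (fam i).Src),
      (fam i).pair n μ ν f f' ≤
        c₀ * Real.exp (-(δ₀ * (fam i).ssdist f f')) * (fam i).l2Norm f * (fam i).l2Norm f' ∧
      (fam i).dpair n μ ν f f' ≤
        c₀ * Real.exp (-(δ₀ * (fam i).ssdist f f')) *
          Real.exp (-(δ₀ * ((fam i).bdistS f + (fam i).bdistS f'))) * (fam i).l2Norm f * (fam i).l2Norm f'

/-! ## §2. Lemmas 2.1, 2.2, the block bound (2.27), Lemma 2.4 -/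

/-- Abstract carrier for Lemmas 2.1–2.2: one INSTANCE = (k, η = L^{−k}; a set □ ⊂ ηℤ^d; a vector field A (resp. Ã) on
□; the charge e).  Printed hypotheses as predicates: `fewLargeBlocks` = "□ an arbitrary sum of unit blocks, but such that
it is a sum of at most few large blocks"; `rect` = □ is a rectangular parallelepiped; `regular` = the field is "as in the
theorem" / "a regular vector field configuration in the sense of Proposition I.2.1"; `constNearBdry` = Ã is "constant in
a neighbourhood of the boundary of □".  Functionals: `l2Norm f` = ‖f‖₂, `supNorm f` = ‖f‖_∞, `lpNorm s f` = ‖f‖_p with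
p = 1/s (s ∈ [0,1], s = 0 the sup norm); `opL2 n μ ν f` (n = 0…3) = ‖G_k(□,A)f‖₂, ‖D^η_{A,μ}G_k(□,A)f‖₂,
‖G_k(□,A)D^{η*}_{A,μ}f‖₂, ‖D^η_{A,μ}G_k(□,A)D^{η*}_{A,ν}f‖₂ (2.15); `holder1 α f` = ‖G_k(□,Ã)f‖_{1,α} with the Hölder norm
(2.14) ‖f‖_{1,α} = max{sup|f|, sup|(D^η_{A,μ}f)(x)|, sup |x′−x|^{−α}|U(A(Γ_{x,x′}))(D^η_{A,μ}f)(x′) − (D^η_{A,μ}f)(x)|};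
`opLq n μ t f` (n = 0…2) = ‖G_k(□,Ã)f‖_q, ‖D^η_{Ã,μ}G_k(□,Ã)f‖_q, ‖G_k(□,Ã)D^{η*}_{Ã,μ}f‖_q with q = 1/t. [cite: Balaban1983RegularityDecay, (2.14)–(2.17) pp.577–578] -/
structure CubeSetting where
  Src : Type
  Dir : Type
  e : ℝ
  fewLargeBlocks : Prop
  rect : Prop
  regular : Prop
  constNearBdry : Prop
  l2Norm : Src → ℝ
  supNorm : Src → ℝ
  lpNorm : ℝ → Src → ℝ
  opL2 : Fin 4 → Dir → Dir → Src → ℝ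
  holder1 : ℝ → Src → ℝ
  opLq : Fin 3 → Dir → ℝ → Src → ℝ

/-- **Lemma 2.1** (p. 577 [PDF 7], verbatim): *"Let a set □ be an arbitrary sum of unit blocks, but such that it is a sum
of at most few large blocks, and let A be as in the theorem. Then for e sufficiently small we have
‖G_k(□,A)f‖₂, ‖D^η_{A,μ}G_k(□,A)f‖₂, ‖G_k(□,A)D^{η*}_{A,μ}f‖₂, ‖D^η_{A,μ}G_k(□,A)D^{η*}_{A,ν}f‖₂ ≤ c₂‖f‖₂. (2.15)"*
Followed by: *"Let us notice that Lemma 2.1 implies that the L²-norm of the operator R given by (2.11) is small for M large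
enough, so the series in the representation (2.12) is convergent in this norm."*  Proof pp. 579–580 via (2.23)–(2.29);
the constant c₀^{−1} = min{π², a_k} of (2.28) is the slip G-B4-03 (see `Display227Printed`). [cite: Balaban1983RegularityDecay, Lemma 2.1 (2.15) p.577] -/
def Lemma21Printed (fam : I → CubeSetting) : Prop :=
  ∃ c₂ e₁ : ℝ, 0 < c₂ ∧ 0 < e₁ ∧ ∀ i : I,
    (fam i).fewLargeBlocks → (fam i).regular → 0 < (fam i).e → (fam i).e ≤ e₁ →
    ∀ (n : Fin 4) (μ ν : (fam i).Dir) (f : (fam i).Src), (fam i).opL2 n μ ν f ≤ c₂ * (fam i).l2Norm f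

/-- **Lemma 2.2** (pp. 577–578 [PDF 7–8], verbatim): *"Let a rectangular parallelepiped □ be a sum of few large blocks
(e.g., as in the case of the cubes □_j), and let Ã be a regular vector field configuration in the sense of Proposition
I.2.1, constant in a neighbourhood of the boundary of □. Then for e sufficiently small and α < 1, there exists a constant
c₁ depending on d, α only, such that ‖G_k(□,Ã)f‖_{1,α} ≤ c₁‖f‖_∞, (2.16) and a constant c₂ depending on d, p₁, such that
‖G_k(□,Ã)f‖_q, ‖D^η_{Ã,μ}G_k(□,Ã)f‖_q, ‖G_k(□,Ã)D^{η*}_{Ã,μ}f‖_q ≤ c₂‖f‖_p (2.17) for 1 ≤ p, q ≤ ∞, satisfying the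
condition 1/p − 1/p₁ ≤ 1/q ≤ 1/p with p₁ > d."*  Exponents are carried by their reciprocals s = 1/p, t = 1/q ∈ [0, 1].
Proof pp. 581–583: reduction Ã ⇒ A₀ constant ⇒ A₀ = 0 ((2.31)–(2.33)), then the renormalization group formula (2.34) +
`Lemma24Printed` + Riesz–Thorin [6] ("Thus Lemma 2.2 is proved, or rather reduced to Lemma 2.4", p. 583). [cite: Balaban1983RegularityDecay, Lemma 2.2 (2.16)–(2.17) pp.577–578] -/
def Lemma22Printed (fam : I → CubeSetting) (d : ℕ) : Prop :=
  (∀ α : ℝ, α < 1 → ∃ c₁ e₁ : ℝ, 0 < c₁ ∧ 0 < e₁ ∧ ∀ i : I,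
    (fam i).rect → (fam i).fewLargeBlocks → (fam i).regular → (fam i).constNearBdry →
    0 < (fam i).e → (fam i).e ≤ e₁ →
    ∀ f : (fam i).Src, (fam i).holder1 α f ≤ c₁ * (fam i).supNorm f) ∧
  (∀ p₁ : ℝ, (d : ℝ) < p₁ → ∃ c₂ e₁ : ℝ, 0 < c₂ ∧ 0 < e₁ ∧ ∀ i : I,
    (fam i).rect → (fam i).fewLargeBlocks → (fam i).regular → (fam i).constNearBdry →
    0 < (fam i).e → (fam i).e ≤ e₁ →
    ∀ (s t : ℝ) (n : Fin 3) (μ : (fam i).Dir) (f : (fam i).Src),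
      0 ≤ t → s ≤ 1 → s - 1 / p₁ ≤ t → t ≤ s → (fam i).opLq n μ t f ≤ c₂ * (fam i).lpNorm s f)

/-- Carrier for the block quadratic-form bound (2.27): one INSTANCE = (k, a unit cube Δ ⊂ ηℤ^d, the constant a_k);
`form φ` = ⟨φ, (−Δ^{η,N}_Δ + a_kP_k)φ⟩ for φ on Δ (A = 0), `l2sq φ` = ‖φ‖²_{L²(Δ)}, `ak` = a_k. [cite: Balaban1983RegularityDecay, (2.26)–(2.27) p.580] -/
structure BlockForm where
  Cfg : Type
  ak : ℝ
  form : Cfg → ℝ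
  l2sq : Cfg → ℝ

/-- **(2.27)** with the sentence before it (p. 580 [PDF 10], verbatim): *"The operator −Δ^{η,N}_Δ is bounded from below
by π² on a subspace of functions on Δ orthogonal to constant functions, which are its eigenvectors corresponding to
eigenvalue 0. The operator P_k is an orthogonal projection on a subspace of constant functions, thus
⟨φ, (−Δ^{η,N}_Δ + a_kP_k)φ⟩ ≥ min{π², a_k}‖φ‖_{L²(Δ)} [sic: ‖φ‖²], (2.27) and from this and (2.26) we get 0 < G_k(□,0) ≤ c₀I,
c₀^{−1} = min{π², a_k}, hence ‖G_k(□,0)f‖₂ ≤ c₀‖f‖₂. (2.28)"*  CENSUS G-B4-03 (FALSE AS PRINTED, harmless): the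
Neumann gap of the discrete Laplacian on a unit cube with η^{−1} = L^k ≥ 2 sites per direction is 4η^{−2}sin²(πη/2) ∈
[8, π²[, never π²; the valid constant is min{8, a_k} (`Display227Repaired`), and since a_k ≤ a ≈ 1 ≤ 8 both minima equal
a_k (`display227_moot`) — the same slip recurs p. 588 ("min{π²L^{−2}, a_{k+1}L^{−2}}") and p. 593 ("½γ₀min{π²L^{−2},
aL^{−2}}") and is moot there for the same reason.  Consumed by B6 (2.11) as "[3, 2.26 and 2.27]". [cite: Balaban1983RegularityDecay, (2.27)–(2.28) p.580] -/
def Display227Printed (fam : I → BlockForm) : Prop :=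
  ∀ (i : I) (φ : (fam i).Cfg), min (Real.pi ^ 2) (fam i).ak * (fam i).l2sq φ ≤ (fam i).form φ

/-- (2.27) with the repaired gap constant 8 = inf_{n ≥ 2} 4n²sin²(π/2n) in place of π² (census G-B4-03). [cite: Balaban1983RegularityDecay, (2.27) p.580] -/
def Display227Repaired (fam : I → BlockForm) : Prop :=
  ∀ (i : I) (φ : (fam i).Cfg), min 8 (fam i).ak * (fam i).l2sq φ ≤ (fam i).form φ

/-- G-B4-03 is moot in the paper's regime: for a ≤ 8 (a fortiori for "a positive constant a close to 1" and a_k ≤ a)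
min{π², a} = min{8, a} = a, so (2.27)/(2.28) as printed and as repaired are the same inequality. [folklore] -/
theorem display227_moot (a : ℝ) (ha : a ≤ 8) : min (Real.pi ^ 2) a = a ∧ min 8 a = a := by
  have hπ : (8 : ℝ) < Real.pi ^ 2 := by nlinarith [Real.pi_gt_three]
  exact ⟨min_eq_right (by linarith), min_eq_right ha⟩

/-- The two typings of (2.27) agree on every family with a_k ≤ 8. [folklore] -/
theorem display227_printed_iff_repaired (fam : I → BlockForm) (h : ∀ i, (fam i).ak ≤ 8) :
    Display227Printed fam ↔ Display227Repaired fam := by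
  constructor
  · intro H i φ
    have := H i φ
    rw [(display227_moot _ (h i)).1] at this
    rw [(display227_moot _ (h i)).2]
    exact this
  · intro H i φ
    have := H i φ
    rw [(display227_moot _ (h i)).2] at this
    rw [(display227_moot _ (h i)).1]
    exact this

/-- Abstract carrier for Lemma 2.4: one INSTANCE = (j ≥ 0, ξ = L^{−j}; a rectangular parallelepiped □ ⊂ ξℤ^d built of
large blocks (`rectLarge`)); `SiteF` = points x ∈ □, `SiteU` = points y ∈ □^{(j)} = □ ∩ ℤ^d, `Dir` = directions;
`distF x y` = |x − y|, `dist2F x x′ y` = dist({x,x′}, y), `distU y y′` = |y − y′|; `kerGQ x y` = |(G_j(□)Q_j^*)(x,y)|,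
`kerDGQ μ x y` = |(∂^{L^{−j}}_μG_j(□)Q_j^*)(x,y)|, `lhs236 α μ x x′ y` = the left-hand side of (2.36), `kerC y y′` =
|C^{(j)}(□; y, y′)|, where G_j(□) = G_j(□, 0) is the one-component A = 0 propagator and C^{(j)}(□) the unit-lattice
propagator of (1.13) (A = 0) entering the renormalization group formula (2.34)
G_k(□) = C^{(0),η}(□) + Σ_{j=1}^{k−1} a_j²(L^jη)^{−4}G^η_j(□)Q_j^*C^{(j),L^jη}(□)Q_jG^η_j(□). [cite: Balaban1983RegularityDecay, (2.34)–(2.37) p.582] -/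
structure ScaleSetting where
  SiteF : Type
  SiteU : Type
  Dir : Type
  rectLarge : Prop
  distF : SiteF → SiteU → ℝ
  dist2F : SiteF → SiteF → SiteU → ℝ
  distU : SiteU → SiteU → ℝ
  kerGQ : SiteF → SiteU → ℝ
  kerDGQ : Dir → SiteF → SiteU → ℝ
  lhs236 : ℝ → Dir → SiteF → SiteF → SiteU → ℝ
  kerC : SiteU → SiteU → ℝ

/-- **Lemma 2.4** (p. 582 [PDF 12], verbatim): *"There exist positive constants c₀, δ₀, and for α < 1, there exists a
constant c₁, such that |(G_j(□)Q_j^*)(x,y)|, |(∂^{L^{−j}}_μG_j(□)Q_j^*)(x,y)| ≤ c₀e^{−δ₀|x−y|}, (2.35)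
|x−x′|^{−α}|(∂^{L^{−j}}_μG_j(□)Q_j^*)(x,y) − (∂^{L^{−j}}_μG_j(□)Q_j^*)(x′,y)| ≤ c₁e^{−δ₀dist({x,x′},y)}, (2.36)
|C^{(j)}(□; y,y′)| ≤ c₀e^{−δ₀|y−y′|}, (2.37) for arbitrary non-negative integer j, arbitrary, rectangular parallelepiped
□ ⊂ L^{−j}Z^d built of large blocks, and x, x′ ∈ □, y, y′ ∈ □^{(j)} = □ ∩ Z^d."*  Proof pp. 584–586: (2.37) "is a special
case of Proposition 2.3 … based on Corollary 2.3 only" (non-circular); (2.35)–(2.36) by the multiple reflection formula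
(2.42) and the momentum representation (2.43)–(2.51) plus a complex contour shift whose j-uniform strip is ASSERTED, NOT
WRITTEN (p. 586: "It is more troublesome, but equally elementary, to prove that this neighbourhood can be chosen
independently of j") = census G-B4-02, inherited by B5 Prop. 1.2 (C-B5-6) and B6 Prop. 2.5. [cite: Balaban1983RegularityDecay, Lemma 2.4 (2.35)–(2.37) p.582] -/
def Lemma24Printed (fam : I → ScaleSetting) : Prop :=
  ∃ c₀ δ₀ : ℝ, 0 < c₀ ∧ 0 < δ₀ ∧
    (∀ i : I, (fam i).rectLarge →
      (∀ (x : (fam i).SiteF) (y : (fam i).SiteU),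
          (fam i).kerGQ x y ≤ c₀ * Real.exp (-(δ₀ * (fam i).distF x y))) ∧
      (∀ (μ : (fam i).Dir) (x : (fam i).SiteF) (y : (fam i).SiteU),
          (fam i).kerDGQ μ x y ≤ c₀ * Real.exp (-(δ₀ * (fam i).distF x y))) ∧
      (∀ y y' : (fam i).SiteU, (fam i).kerC y y' ≤ c₀ * Real.exp (-(δ₀ * (fam i).distU y y')))) ∧
    (∀ α : ℝ, α < 1 → ∃ c₁ : ℝ, 0 < c₁ ∧ ∀ i : I, (fam i).rectLarge →
      ∀ (μ : (fam i).Dir) (x x' : (fam i).SiteF) (y : (fam i).SiteU),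
        (fam i).lhs236 α μ x x' y ≤ c₁ * Real.exp (-(δ₀ * (fam i).dist2F x x' y)))

/-! ## §1/§3. The unit-lattice propagators C^{(k)}_Λ(Ω, A): "Proposition 2.3 of [1]" -/

/-- Abstract carrier for "Proposition 2.3 of [1]": one INSTANCE = (k; Ω ⊂ Ω₀ unions of big blocks; A regular; the
charge e; Λ ⊂ Ω^{(k)} = Ω ∩ ℤ^d "a sum of big blocks").  Objects (p. 573, (1.13)–(1.14), X|_Λ = ΛXΛ):
C^{(k)}_Λ(Ω,A) = ((Δ^{(k)}(Ω,A) + aL^{−2}P(A))|_Λ)^{−1} (1.13), Δ^{(k)}(Ω,A) = a_kI − a_k²Q_k(A)G_k(Ω,A)Q_k^*(A) (1.14)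
("a_k is a constant proportional to a"; P(A) = Q^*(A)Q(A) the next-level L-block averaging projection on the unit
lattice, imported from [1] and written out at (5.1) p. 593 — transcription C-B4-2: the leaf record L-B4-4 reads "P(Λ)",
the page render reads P(A)); C^{(k)}(Ω,A) = the case Λ = Ω^{(k)}; δC^{(k)}_Λ(Ω,A) = C^{(k)}_Λ(Ω,A) − C^{(k)}(Ω,A) (1.17);
δC^{(k)}_Λ(Ω,Ω₀,A) = C^{(k)}_Λ(Ω,A) − C^{(k)}_Λ(Ω₀,A) (1.19).  Fields: `LSite` = points of Λ, `udist x x′` = |x − x′|,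
`distLc x` = dist(x, Λᶜ), `distOc x` = dist(x, Ω^{(k)c}), `kerC x x′` = |C^{(k)}_Λ(Ω,A; x,x′)|, `kerDC x x′` =
|δC^{(k)}_Λ(Ω,A; x,x′)|, `kerDC0 x x′` = |δC^{(k)}_Λ(Ω,Ω₀,A; x,x′)|, `form115 γ₀ γ₁` = the operator inequality
γ₀I ≤ Δ^{(k)}(Ω,A) + aL^{−2}P(A) ≤ γ₁I on L²(Ω^{(k)}); predicates `regular`, `bigBlocks` as printed. [cite: Balaban1983RegularityDecay, (1.13)–(1.20) pp.573–574] -/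
structure UnitSetting where
  LSite : Type
  e : ℝ
  regular : Prop
  bigBlocks : Prop
  udist : LSite → LSite → ℝ
  distLc : LSite → ℝ
  distOc : LSite → ℝ
  kerC : LSite → LSite → ℝ
  kerDC : LSite → LSite → ℝ
  kerDC0 : LSite → LSite → ℝ
  form115 : ℝ → ℝ → Prop

/-- **Proposition 2.3 of [1]** (p. 574 [PDF 4], verbatim; surge node T01.2): *"There exist positive constants δ₀, c₀, γ₀,
γ₁ dependent on d and M only and such that for arbitrary Λ ⊂ Ω^{(k)} = Ω ∩ Z^d, Λ being a sum of big blocks and for e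
sufficiently small, we have γ₀I ≤ Δ^{(k)}(Ω,A) + aL^{−2}P(A) ≤ γ₁I, (1.15) |C^{(k)}_Λ(Ω,A; x,x′)| ≤ c₀ exp(−δ₀|x−x′|),
x, x′ ∈ Λ. (1.16) In particular the above inequality holds for C^{(k)}(Ω,A). Putting δC^{(k)}_Λ(Ω,A) = C^{(k)}_Λ(Ω,A) −
C^{(k)}(Ω,A), (1.17) we have also |δC^{(k)}_Λ(Ω,A; x,x′)| ≤ c₀ exp(−δ₀(|x−x′| + dist(x,Λᶜ) + dist(x′,Λᶜ))), x, x′ ∈ Λ.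
(1.18) Finally, for Ω ⊂ Ω₀ and δC^{(k)}_Λ(Ω,Ω₀,A) = C^{(k)}_Λ(Ω,A) − C^{(k)}_Λ(Ω₀,A), (1.19) we have
|δC^{(k)}_Λ(Ω,Ω₀,A; x,x′)| ≤ c₀ exp(−δ₀(|x−x′| + dist(x,Ω^{(k)c}) + dist(x′,Ω^{(k)c}))), x, x′ ∈ Λ. (1.20)"*
TWO printed proofs: §3 pp. 586–589 (explicit Gaussian representation (3.1)–(3.8) + Corollary 2.3 for G_k(Ω,Λ,A) (3.5),
asserted "with only slight changes", census G-B4-04; (1.18) via the resolvent identity (3.9)–(3.10), certified G-B4-05;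
p. 588: "Generally we have to expect that bounds on C^{(k)}_Λ(Ω,A) will depend on L") and §5 pp. 593–594 (`Sect5ThmUniform`
applied to A = Δ^{(k)}(Ω₀,A) + aL^{−2}P(A) with (5.3) ⇐ `Prop31Printed`, (5.4)–(5.5) ⇐ `Cor23Printed`).  "dependent on
d and M only" silently includes L (cf. census C-B5-5) — D-b04.4. [cite: Balaban1983RegularityDecay, Prop. 2.3 of [1] (1.15)–(1.20) p.574] -/
def Prop23Printed (fam : I → UnitSetting) : Prop :=
  ∃ δ₀ c₀ γ₀ γ₁ e₁ : ℝ, 0 < δ₀ ∧ 0 < c₀ ∧ 0 < γ₀ ∧ 0 < γ₁ ∧ 0 < e₁ ∧ ∀ i : I,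
    (fam i).regular → (fam i).bigBlocks → 0 < (fam i).e → (fam i).e ≤ e₁ →
    (fam i).form115 γ₀ γ₁ ∧
    (∀ x x' : (fam i).LSite, (fam i).kerC x x' ≤ c₀ * Real.exp (-(δ₀ * (fam i).udist x x'))) ∧
    (∀ x x' : (fam i).LSite, (fam i).kerDC x x' ≤
        c₀ * Real.exp (-(δ₀ * ((fam i).udist x x' + (fam i).distLc x + (fam i).distLc x')))) ∧
    (∀ x x' : (fam i).LSite, (fam i).kerDC0 x x' ≤
        c₀ * Real.exp (-(δ₀ * ((fam i).udist x x' + (fam i).distOc x + (fam i).distOc x'))))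

/-! ## §1/§4. The lower bound for Δ^{(k)}(Ω, A): "Proposition 3.1′ of [2]" -/

/-- Abstract carrier for "Proposition 3.1′ of [2]": one INSTANCE = (k; Ω "a sum of unit blocks (i.e. Ω^{(k)} is an
arbitrary subset of Z^d)" (`unitBlocks`); A with (1.21) |(∂^η_μA)(x)| ≤ O(1)p(e), p(e) = a₀(1 + log e^{−1})^p (`reg121`);
the charge e; m² = `massSq`); `Cfg` = functions φ on Ω^{(k)}, `form φ` = ⟨φ, Δ^{(k)}(Ω,A)φ⟩, `covDiffSq φ` =
Σ_{⟨x,x′⟩⊂Ω^{(k)}}|U(A(⟨x,x′⟩))φ(x′) − φ(x)|², `l2sq φ` = Σ_{x∈Ω^{(k)}}|φ(x)|². [cite: Balaban1983RegularityDecay, (1.21)–(1.22) p.574] -/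
structure FormSetting where
  Cfg : Type
  e : ℝ
  massSq : ℝ
  unitBlocks : Prop
  reg121 : Prop
  form : Cfg → ℝ
  covDiffSq : Cfg → ℝ
  l2sq : Cfg → ℝ

/-- **Proposition 3.1′ of [2]** (p. 574 [PDF 4], verbatim; surge node T01.3): *"Let Ω be a sum of unit blocks (i.e.
Ω^{(k)} is an arbitrary subset of Z^d) and let A satisfies the condition |(∂^η_μA)(x)| ≤ O(1)p(e) (p(e) = a₀(1 + log
e^{−1})^p), (1.21) then there exists a positive constant γ₀ depending on d only, such that for e sufficiently small
⟨φ, Δ^{(k)}(Ω,A)φ⟩ ≥ γ₀(Σ_{⟨x,x′⟩⊂Ω^{(k)}}|U(A(⟨x,x′⟩))φ(x′) − φ(x)|² + m²Σ_{x∈Ω^{(k)}}|φ(x)|²) − O(1)e^{2−α}Σ_{x∈Ω^{(k)}}|φ(x)|²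
(1.22) for arbitrary α > 0 and a constant O(1) depending on α and the other constants, but independent of Ω, k, A, and for
an arbitrary function φ."*  ("This theorem implies (3.29) of [2].")  Quantifier order (literal): γ₀ and the smallness
threshold, then α > 0, then O(1) = C(α), then the instance.  Printed proof §4 pp. 589–593: (4.4) (mass part, under the
silent assumption m² ≤ O(1) — D-b04.3) and (4.6)–(4.7) (bond part, 2d matchings) combine with γ₀ = ½min{γ₀′/(2d),
a_k/(a_k + O(1))} (`prop31_gamma0`); (4.7) ⇐ (4.11)–(4.13) with γ₀′ = ¼γ₀″ (`gamma0prime_chain`), importing (I.3.15),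
(I.3.44), Lemma II.2.4 / II.2.75 (census G-B4-06/07); (4.12) ⇔ (4.14) ⇐ the duality computation (4.15)–(4.22) (G-B4-08:
the η-uniformity of (4.22) is unstated). [cite: Balaban1983RegularityDecay, Prop. 3.1′ of [2] (1.21)–(1.22) p.574] -/
def Prop31Printed (fam : I → FormSetting) : Prop :=
  ∃ γ₀ e₁ : ℝ, 0 < γ₀ ∧ 0 < e₁ ∧ ∀ α : ℝ, 0 < α → ∃ C : ℝ, 0 ≤ C ∧ ∀ i : I,
    (fam i).unitBlocks → (fam i).reg121 → 0 < (fam i).e → (fam i).e ≤ e₁ →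
    ∀ φ : (fam i).Cfg,
      γ₀ * ((fam i).covDiffSq φ + (fam i).massSq * (fam i).l2sq φ) -
          C * (fam i).e ^ ((2 : ℝ) - α) * (fam i).l2sq φ ≤ (fam i).form φ

/-- KERNEL-CHECKED bookkeeping of §4, p. 590 [PDF 20]: *"Then γ₀ = ½min{γ₀′/(2d), a_k/(a_k + O(1))}"*.  With F = ⟨φ,
Δ^{(k)}φ⟩, S = Σ|φ(x)|², D = the covariant bond sum, E = e²p²(e): the mass bound (4.4) F ≥ a_km²/(a_k + m²)·S (for
m² ≤ B = O(1)) and the averaged bond bound (4.6) + (4.7) F ≥ (γ′/2d)D − K·E·S (each point lies in ≤ 2d bonds) give (1.22)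
with γ₀ = ½min{γ′/(2d), a_k/(a_k + B)} and error constant ½K. [folklore] -/
theorem prop31_gamma0 (F S D m2 ak B γ' K E dd : ℝ) (hak : 0 < ak) (hm : 0 ≤ m2)
    (hmB : m2 ≤ B) (hS : 0 ≤ S) (hD : 0 ≤ D)
    (h44 : ak * m2 / (ak + m2) * S ≤ F) (h46 : γ' / (2 * dd) * D - K * E * S ≤ F) :
    1 / 2 * min (γ' / (2 * dd)) (ak / (ak + B)) * (D + m2 * S) - 1 / 2 * (K * E * S) ≤ F := by
  have hB : 0 < ak + B := by linarith
  have hm' : 0 < ak + m2 := by linarith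
  have step1 : ak / (ak + B) * m2 ≤ ak * m2 / (ak + m2) := by
    have hrec : 1 / (ak + B) ≤ 1 / (ak + m2) := one_div_le_one_div_of_le hm' (by linarith)
    have hnn : 0 ≤ ak * m2 := mul_nonneg hak.le hm
    calc ak / (ak + B) * m2 = ak * m2 * (1 / (ak + B)) := by ring
      _ ≤ ak * m2 * (1 / (ak + m2)) := mul_le_mul_of_nonneg_left hrec hnn
      _ = ak * m2 / (ak + m2) := by ring
  have hmin1 : min (γ' / (2 * dd)) (ak / (ak + B)) ≤ γ' / (2 * dd) := min_le_left _ _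
  have hmin2 : min (γ' / (2 * dd)) (ak / (ak + B)) ≤ ak / (ak + B) := min_le_right _ _
  have h1 : min (γ' / (2 * dd)) (ak / (ak + B)) * D ≤ γ' / (2 * dd) * D :=
    mul_le_mul_of_nonneg_right hmin1 hD
  have h2 : min (γ' / (2 * dd)) (ak / (ak + B)) * (m2 * S) ≤ ak / (ak + B) * (m2 * S) :=
    mul_le_mul_of_nonneg_right hmin2 (mul_nonneg hm hS)
  have h3 : ak / (ak + B) * (m2 * S) ≤ ak * m2 / (ak + m2) * S := by
    have := mul_le_mul_of_nonneg_right step1 hS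
    calc ak / (ak + B) * (m2 * S) = ak / (ak + B) * m2 * S := by ring
      _ ≤ ak * m2 / (ak + m2) * S := this
  have key : 1 / 2 * min (γ' / (2 * dd)) (ak / (ak + B)) * (D + m2 * S) =
      1 / 2 * (min (γ' / (2 * dd)) (ak / (ak + B)) * D) +
        1 / 2 * (min (γ' / (2 * dd)) (ak / (ak + B)) * (m2 * S)) := by ring
  rw [key]
  linarith

/-- KERNEL-CHECKED bookkeeping of §4, p. 591 [PDF 21]: (4.12) L₀ ≥ γ₀″X₀ (X₀ = |U(A₀(⟨x,x′⟩))φ(x′) − φ(x)|², L₀ = the left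
side of (4.7) at A₀), (4.11) with δ = ½γ₀″: L ≥ L₀ − ½γ₀″X₀ − O(γ₀″^{−1})e²p²(e)W, and (4.13) X₀ ≥ ½X − O(1)e²p²(e)W′
(X = |U(A(⟨x,x′⟩))φ(x′) − φ(x)|²; W, W′ sums of |φ(x)|², |φ(x′)|², here merged into one W ≥ both) *"give (4.7) with γ₀′ =
¼γ₀″"*. [folklore] -/
theorem gamma0prime_chain (L L₀ X X₀ W γ'' K K' E : ℝ) (hγ : 0 < γ'')
    (h412 : γ'' * X₀ ≤ L₀) (h411 : L₀ - γ'' / 2 * X₀ - K * E * W ≤ L)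
    (h413 : X / 2 - K' * E * W ≤ X₀) :
    γ'' / 4 * X - (γ'' / 2 * K' + K) * E * W ≤ L := by
  have h := mul_le_mul_of_nonneg_left h413 (le_of_lt (half_pos hγ))
  linarith

/-! ## §5. "A General Theorem on Unit Lattice Operators" (p. 594) — typed concretely -/

section UnitLattice

variable {d N : ℕ}

/-- The index set of L²(Ω) ∋ φ : Ω → ℝ^N for a finite Ω ⊂ ℤ^d: a point of Ω and a component.  (The print allows any
Ω ⊂ ℤ^d; every application in the series has Ω finite — a subset of a torus or of a bounded region — and the content of
the theorem is the UNIFORMITY of the constants in Ω, Λ; finite Ω is typed — D-b04.5.) [cite: Balaban1983RegularityDecay, Sect. 5 Theorem p.594] -/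
abbrev Idx (Ω : Finset (Fin d → ℤ)) (N : ℕ) : Type := ↥Ω × Fin N

/-- The inclusion Λ ⊆ Ω on indices. [folklore] -/
def inclIdx {Ω Λ : Finset (Fin d → ℤ)} (h : Λ ⊆ Ω) : Idx Λ N → Idx Ω N :=
  fun p => (⟨p.1.1, h p.1.2⟩, p.2)

/-- "A_Λ is an operator defined on L²(Λ) by A_Λ = ΛAΛ" (p. 594): the compression of the kernel A to Λ ⊆ Ω. [cite: Balaban1983RegularityDecay, Sect. 5 Theorem p.594] -/
def compress {Ω Λ : Finset (Fin d → ℤ)} (h : Λ ⊆ Ω) (A : Matrix (Idx Ω N) (Idx Ω N) ℝ) :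
    Matrix (Idx Λ N) (Idx Λ N) ℝ :=
  A.submatrix (inclIdx h) (inclIdx h)

/-- Condition **(5.6)** (p. 594, verbatim): *"A ≥ γ₀I, |A(x,x′)| ≤ c₀e^{−δ₀|x−x′|}, x, x′ ∈ Ω"* for "a symmetric operator
defined on the space L²(Ω) of functions φ : Ω → R^N": symmetry of the kernel, the quadratic-form lower bound, and the
entrywise kernel bound (|x − x′| = the sup-distance of ℤ^d; the print's |A(x,x′)| is a norm of the N × N block — entrywise
typing changes constants by N-dependent factors only, D-b04.6). [cite: Balaban1983RegularityDecay, (5.6) p.594] -/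
def Hyp56 (Ω : Finset (Fin d → ℤ)) (A : Matrix (Idx Ω N) (Idx Ω N) ℝ) (γ₀ c₀ δ₀ : ℝ) : Prop :=
  A.IsSymm ∧
  (∀ v : Idx Ω N → ℝ, γ₀ * ∑ p, v p ^ 2 ≤ ∑ p, v p * A.mulVec v p) ∧
  (∀ p q : Idx Ω N,
    |A p q| ≤ c₀ * Real.exp (-(δ₀ * dist (p.1 : Fin d → ℤ) (q.1 : Fin d → ℤ))))

/-- Conclusions **(5.7)–(5.8)** (p. 594, verbatim) for one Λ ⊂ Ω with constants c₁, δ₁: *"for C_Λ = A_Λ^{−1} … We have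
|C_Λ(x,x′)| ≤ c₁e^{−δ₁|x−x′|}, x, x′ ∈ Λ, (5.7) |δC_Λ(x,x′)| ≤ c₁e^{−δ₁(|x−x′| + dist(x,Λᶜ) + dist(x′,Λᶜ))}, δC_Λ = C_Λ −
C_Ω. (5.8)"*  Here Λᶜ = "the complement Λᶜ of Λ in Ω" (p. 596); C_Λ = `(compress h A)⁻¹` (Mathlib's `Matrix.inv`, the
true inverse since A_Λ ≥ γ₀I is invertible); `Metric.infDist` to an empty set is 0, which only weakens (5.8) at Λ = Ω
(where δC_Ω = 0 anyway). [cite: Balaban1983RegularityDecay, (5.7)–(5.8) p.594] -/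
def Concl57_58 (Ω Λ : Finset (Fin d → ℤ)) (h : Λ ⊆ Ω) (A : Matrix (Idx Ω N) (Idx Ω N) ℝ)
    (c₁ δ₁ : ℝ) : Prop :=
  (∀ p q : Idx Λ N, |(compress h A)⁻¹ p q| ≤
      c₁ * Real.exp (-(δ₁ * dist (p.1 : Fin d → ℤ) (q.1 : Fin d → ℤ)))) ∧
  (∀ p q : Idx Λ N, |(compress h A)⁻¹ p q - A⁻¹ (inclIdx h p) (inclIdx h q)| ≤
      c₁ * Real.exp (-(δ₁ * (dist (p.1 : Fin d → ℤ) (q.1 : Fin d → ℤ)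
        + Metric.infDist (p.1 : Fin d → ℤ) (((Ω \ Λ : Finset (Fin d → ℤ))) : Set (Fin d → ℤ))
        + Metric.infDist (q.1 : Fin d → ℤ) (((Ω \ Λ : Finset (Fin d → ℤ))) : Set (Fin d → ℤ))))))

/-- Condition **(5.9)** (p. 594, verbatim): *"|B(x,x′)| ≤ c₀e^{−δ₀(|x−x′| + dist(x,Ωᶜ) + dist(x′,Ωᶜ))}, x, x′ ∈ Ω"*
(Ωᶜ = the complement in ℤ^d). [cite: Balaban1983RegularityDecay, (5.9) p.594] -/
def Hyp59 (Ω : Finset (Fin d → ℤ)) (B : Matrix (Idx Ω N) (Idx Ω N) ℝ) (c₀ δ₀ : ℝ) : Prop :=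
  ∀ p q : Idx Ω N, |B p q| ≤
    c₀ * Real.exp (-(δ₀ * (dist (p.1 : Fin d → ℤ) (q.1 : Fin d → ℤ)
      + Metric.infDist (p.1 : Fin d → ℤ) ((Ω : Set (Fin d → ℤ)))ᶜ
      + Metric.infDist (q.1 : Fin d → ℤ) ((Ω : Set (Fin d → ℤ)))ᶜ)))

/-- Conclusion **(5.10)** (p. 594, verbatim) for one Λ ⊂ Ω: *"|A_Λ^{−1}(x,x′) − (A+B)_Λ^{−1}(x,x′)| ≤
c₁e^{−δ₁(|x−x′| + dist(x,Ωᶜ) + dist(x′,Ωᶜ))}, x, x′ ∈ Λ. (5.10)"* [cite: Balaban1983RegularityDecay, (5.10) p.594] -/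
def Concl510 (Ω Λ : Finset (Fin d → ℤ)) (h : Λ ⊆ Ω) (A B : Matrix (Idx Ω N) (Idx Ω N) ℝ)
    (c₁ δ₁ : ℝ) : Prop :=
  ∀ p q : Idx Λ N, |(compress h A)⁻¹ p q - (compress h (A + B))⁻¹ p q| ≤
    c₁ * Real.exp (-(δ₁ * (dist (p.1 : Fin d → ℤ) (q.1 : Fin d → ℤ)
      + Metric.infDist (p.1 : Fin d → ℤ) ((Ω : Set (Fin d → ℤ)))ᶜ
      + Metric.infDist (q.1 : Fin d → ℤ) ((Ω : Set (Fin d → ℤ)))ᶜ)))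

variable (d N)

/-- **Sect. 5 Theorem** (p. 594 [PDF 24], verbatim; surge node T01.4), LITERAL quantifier reading: *"Theorem. Let Ω ⊂ Z^d
and let A be a symmetric operator defined on the space L²(Ω) of functions φ : Ω → R^N and satisfying the following
condition: there exist positive constants γ₀, c₀, δ₀ such that A ≥ γ₀I, |A(x,x′)| ≤ c₀e^{−δ₀|x−x′|}, x, x′ ∈ Ω. (5.6) Then
there exist positive constants c₁, δ₁ such that for arbitrary Λ ⊂ Ω and for C_Λ = A_Λ^{−1}, A_Λ is an operator defined on
L²(Λ) by A_Λ = ΛAΛ. We have |C_Λ(x,x′)| ≤ c₁e^{−δ₁|x−x′|}, x, x′ ∈ Λ, (5.7) |δC_Λ(x,x′)| ≤ c₁e^{−δ₁(|x−x′| + dist(x,Λᶜ) +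
dist(x′,Λᶜ))}, δC_Λ = C_Λ − C_Ω. (5.8) If we perturb the operator A by an operator B such that the condition (5.6) is
satisfied for A + B, and additionally B has the property |B(x,x′)| ≤ c₀e^{−δ₀(|x−x′| + dist(x,Ωᶜ) + dist(x′,Ωᶜ))}, x, x′ ∈ Ω,
(5.9) then we have also |A_Λ^{−1}(x,x′) − (A+B)_Λ^{−1}(x,x′)| ≤ c₁e^{−δ₁(|x−x′| + dist(x,Ωᶜ) + dist(x′,Ωᶜ))}, x, x′ ∈ Λ.
(5.10)"*  In this reading c₁, δ₁ are chosen after (Ω, A). [cite: Balaban1983RegularityDecay, Sect. 5 Theorem (5.6)–(5.10) p.594] -/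
def Sect5ThmLiteral : Prop :=
  ∀ (Ω : Finset (Fin d → ℤ)) (A : Matrix (Idx Ω N) (Idx Ω N) ℝ) (γ₀ c₀ δ₀ : ℝ),
    0 < γ₀ → 0 < c₀ → 0 < δ₀ → Hyp56 Ω A γ₀ c₀ δ₀ →
    ∃ c₁ δ₁ : ℝ, 0 < c₁ ∧ 0 < δ₁ ∧
      (∀ (Λ : Finset (Fin d → ℤ)) (h : Λ ⊆ Ω), Concl57_58 Ω Λ h A c₁ δ₁) ∧
      (∀ B : Matrix (Idx Ω N) (Idx Ω N) ℝ, Hyp56 Ω (A + B) γ₀ c₀ δ₀ → Hyp59 Ω B c₀ δ₀ →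
        ∀ (Λ : Finset (Fin d → ℤ)) (h : Λ ⊆ Ω), Concl510 Ω Λ h A B c₁ δ₁)

/-- **Sect. 5 Theorem**, UNIFORM reading — the one the proof establishes and the consumers (B6 pp. 237, 242, "exponential
decay independent of j and Λ"; B9 p. 428) use: p. 596 fixes M by "γ₀^{−1}αe^{dδ₂}c₂^{2d} < 1", (5.21) gives δ₁ =
½δ₂M^{−1} with δ₂ = ¼δ₀, and p. 597 [PDF 27] closes with (verbatim) *"Thus Inequality (5.10) is proved. The constants δ₁,
c₁ are functions of δ₀, γ₀, c₀, and from the above proof we can get more precise estimates for them."*  Hence: for every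
(γ₀, c₀, δ₀) there are (c₁, δ₁) (depending also on d, N) valid for ALL finite Ω ⊂ ℤ^d, all A with (5.6), all Λ ⊂ Ω and all
admissible B.  Census C-B4-3: proof pp. 594–597 certified modulo routine constant re-selection (Schur bound over the
finitely-overlapping cubes □_j, the walk count 2n ≤ 4^n at (5.27)). [cite: Balaban1983RegularityDecay, Sect. 5 Theorem p.594 + p.597] -/
def Sect5ThmUniform : Prop :=
  ∀ γ₀ c₀ δ₀ : ℝ, 0 < γ₀ → 0 < c₀ → 0 < δ₀ → ∃ c₁ δ₁ : ℝ, 0 < c₁ ∧ 0 < δ₁ ∧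
    ∀ (Ω : Finset (Fin d → ℤ)) (A : Matrix (Idx Ω N) (Idx Ω N) ℝ), Hyp56 Ω A γ₀ c₀ δ₀ →
      (∀ (Λ : Finset (Fin d → ℤ)) (h : Λ ⊆ Ω), Concl57_58 Ω Λ h A c₁ δ₁) ∧
      (∀ B : Matrix (Idx Ω N) (Idx Ω N) ℝ, Hyp56 Ω (A + B) γ₀ c₀ δ₀ → Hyp59 Ω B c₀ δ₀ →
        ∀ (Λ : Finset (Fin d → ℤ)) (h : Λ ⊆ Ω), Concl510 Ω Λ h A B c₁ δ₁)

variable {d N}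

/-- The uniform reading implies the literal one. [folklore] -/
theorem sect5_literal_of_uniform (h : Sect5ThmUniform d N) : Sect5ThmLiteral d N := by
  intro Ω A γ₀ c₀ δ₀ hγ hc hδ hA
  obtain ⟨c₁, δ₁, hc₁, hδ₁, H⟩ := h γ₀ c₀ δ₀ hγ hc hδ
  exact ⟨c₁, δ₁, hc₁, hδ₁, (H Ω A hA).1, (H Ω A hA).2⟩

end UnitLattice

/-- KERNEL-CHECKED identity behind **(5.1)** p. 593 [PDF 23] (*"Δ^{(k)}(Ω,A) + aL^{−2}P(A) ≤ … ≤ (a_k + aL^{−2})I =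
a(a_k/a_{k+1})I"*) and (3.4) p. 587 (*"using the recursive relation a_{k+1} = aa_k/(aL^{−2} + a_k)"*): with ℓ = L^{−2},
a_k + aℓ = a·a_k/a_{k+1}. [folklore] -/
theorem recursion_51 (a ak ℓ : ℝ) (ha : 0 < a) (hak : 0 < ak) (hℓ : 0 < ℓ) :
    ak + a * ℓ = a * ak / (a * ak / (a * ℓ + ak)) := by
  have h1 : a * ℓ + ak ≠ 0 := by positivity
  have h2 : a * ak ≠ 0 := by positivity
  field_simp
  ring

/-- KERNEL-CHECKED step behind **(5.21)** p. 596 [PDF 26] (*"This inequality implies (5.7) with δ₁ = ½δ₂M^{−1}"*): if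
x ∈ □_j, x′ ∈ □_{j′} (cubes of size 2M centred at Mj, Mj′) then |x − x′| ≤ M(|j − j′| + 2d′) for the relevant lattice
norms, so e^{−½δ₂|j−j′|} ≤ e^{d′δ₂}e^{−½δ₂M^{−1}|x−x′|}. [folklore] -/
theorem walk_to_distance (δ₂ M D J d' : ℝ) (hM : 0 < M) (hδ : 0 ≤ δ₂) (h : D ≤ M * (J + 2 * d')) :
    Real.exp (-(δ₂ / 2 * J)) ≤ Real.exp (d' * δ₂) * Real.exp (-(δ₂ / (2 * M) * D)) := by
  rw [← Real.exp_add]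
  apply Real.exp_le_exp.mpr
  have hM' : M ≠ 0 := ne_of_gt hM
  have h1 : δ₂ / (2 * M) * D ≤ δ₂ / (2 * M) * (M * (J + 2 * d')) :=
    mul_le_mul_of_nonneg_left h (by positivity)
  have h2 : δ₂ / (2 * M) * (M * (J + 2 * d')) = δ₂ / 2 * J + d' * δ₂ := by
    field_simp
  linarith

/-! ## The leaf of the series DAG delivered by this paper -/

/-- The conclusion block of B4 as the series uses it (the intended content of `…Balaban1983to89.Dag.Leaves.b4`: "Theorem
p. 573 (= Prop. 2.1 of (Higgs)₂,₃ I), Prop. 2.3 of I and Prop. 3.1′ of II as restated p. 574, Sect. 5 Theorem p. 594"),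
over the families of instances the binding chooses; the Sect. 5 Theorem in its uniform reading. [cite: Balaban1983RegularityDecay, Theorem p.573, Props. p.574, Sect. 5 Theorem p.594] -/
def LeafB4 {I₁ I₂ I₃ : Type} (famE : I₁ → EtaSetting) (famU : I₂ → UnitSetting) (famF : I₃ → FormSetting)
    (d N : ℕ) : Prop :=
  ThmPrinted famE ∧ Prop23Printed famU ∧ Prop31Printed famF ∧ Sect5ThmUniform d N

/-- Assembling the leaf from its four printed statements (surge nodes T01.1–T01.4). [folklore] -/
theorem leafB4_intro {I₁ I₂ I₃ : Type} {famE : I₁ → EtaSetting} {famU : I₂ → UnitSetting}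
    {famF : I₃ → FormSetting} {d N : ℕ} (h₁ : ThmPrinted famE) (h₂ : Prop23Printed famU)
    (h₃ : Prop31Printed famF) (h₄ : Sect5ThmUniform d N) : LeafB4 famE famU famF d N :=
  ⟨h₁, h₂, h₃, h₄⟩

/-- From the leaf, the Sect. 5 Theorem is available in both printed readings. [folklore] -/
theorem leafB4_sect5_literal {I₁ I₂ I₃ : Type} {famE : I₁ → EtaSetting} {famU : I₂ → UnitSetting}
    {famF : I₃ → FormSetting} {d N : ℕ} (h : LeafB4 famE famU famF d N) : Sect5ThmLiteral d N :=
  sect5_literal_of_uniform h.2.2.2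

end Literature.MathematicalPhysics.QuantumFieldTheory.Balaban1983to89.B4
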